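import Literature.NumberTheory.Sieve.GreenTao2008SharpGYTuples
import Literature.NumberTheory.Sieve.GreenTao2008LinearFormsProofs
import Mathlib.Analysis.SpecificLimits.Normed
import HarnessLib

/-!
# Green–Tao (2008), Proposition 9.8 PROVED: the linear forms condition for the majorant `ν`

Trunk T-SIEVE. Final file of the proof of `Literature.NumberTheory.Sieve.GreenTao2008.MeasureLinearForms`
(B. Green, T. Tao, *The primes contain arbitrarily long arithmetic progressions*, Ann. of Math. 167
(2008), Proposition 9.8: the measure `ν` of Definition 9.3 satisfies the `(k2^{k-1}, 3k-4, k)`-linear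
forms condition). The tree already contains the printed deduction of Prop. 9.8 from the
Goldston–Yıldırım asymptotic on boxes (`linearFormsCondition_of_boxAsymptotic`, used by
`MeasureLinearForms_of`), which needs that asymptotic only for the fixed coefficient bound `k · k!`.
Here that asymptotic — Proposition 9.5 of the source for fixed `(m, t, C)`, for the SHARP truncation
`Λ_R` of Definition 9.2 — is proved (`sharp_boxAsymptotic`), and Prop. 9.8 follows
(`MeasureLinearForms_holds`).

The proof of the box asymptotic assembles files I–III (`GreenTao2008SharpGY{Moebius,Diagonal,Tuples}`):

* `truncatedDivisorSum = log R · divSum(c_R)` with `c_R(d) = μ(d) λ_R(d)/log R` (`|c_R| ≤ 1`), so the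
  tree's expansion over tuples and passage to local densities (`CFZ.expect_prod_sq_divSum_eq`,
  `CFZ.abs_sum_coef_mul_expect_sub_tupleDensity_le`) give
  `E_{x∈B} ∏_i Λ_R(θ_i(x))² = S(P) + O(t (log R)^{2m} R^{4m}/ℓ_min)` with `S(P) = sharpTupleSum`
  (`expect_prod_sq_eq_sharpTupleSum_add`);
* `S(P) = S₁(W;R,R)^m + O((e^{2·16^m/w} - 1)(B²(W/φ(W))² G_W(R))^m)` (file III);
* `S₁(W;R,R) = (1 + o(1)) (W/φ(W)) log R` as `w → ∞`, `log R ≥ 64^w → ∞` (`abs_diagSum_div_sub_one_le`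
  and `exists_main_term_thresholds`: the two-sided bounds of file II with the Rankin cut
  `Y₀ = U P₀² e^{2√log R}`, `P₀ = 5^{w+1} exp(4 (w log 4 + log R)/(log 2 √w))`, and the tree's
  evaluation of `G_W`).

"`w(N)` sufficiently slowly growing" is the growth bound `G(N) = ⌊log_64 log R⌋` (so that
`64^{w(N)} ≤ log R`), exactly in the format of `MeasureLinearForms`.

## References

* B. Green, T. Tao, Ann. of Math. (2) 167 (2008), 481–547: Def. 9.2–9.3, Prop. 9.5, Prop. 9.8 and its
  proof (pp. 526–528), §10, App. A. [cite: GreenTaoAnnals2008]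
-/

noncomputable section

open Finset Filter Real Topology
open scoped ArithmeticFunction.Moebius BigOperators

namespace Literature.NumberTheory.Sieve.GreenTao2008.SharpGY

open Literature.NumberTheory.Sieve.CFZ
open Literature.NumberTheory.Sieve.SquarefreeSums (harmErr bConst harmErr_nonneg one_le_bConst)

variable {m t : ℕ}

/-! ### `Λ_R` as a normalised divisor sum and the passage to `sharpTupleSum` -/

/-- The normalised sharp coefficient `c_R(d) = μ(d) λ_R(d)/log R` (`|c_R| ≤ 1`).
[cite: GreenTaoAnnals2008, Definition 9.2] -/
def sharpCoef (R : ℝ) (d : ℕ) : ℝ := (μ d : ℝ) * lamR R d / Real.log R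

/-- `|c_R(d)| ≤ 1` (`R > 1`). [cite: GreenTaoAnnals2008, Definition 9.2] -/
theorem abs_sharpCoef_le {R : ℝ} (hR : 1 < R) (d : ℕ) : |sharpCoef R d| ≤ 1 := by
  unfold sharpCoef
  have hL : 0 < Real.log R := Real.log_pos hR
  rcases Nat.eq_zero_or_pos d with rfl | hd
  · simp
  · have hμ : |(μ d : ℝ)| ≤ 1 := by rw [← Int.cast_abs]; exact_mod_cast ArithmeticFunction.abs_moebius_le_one
    rw [abs_div, abs_mul, abs_of_pos hL, abs_of_nonneg (lamR_nonneg R d), div_le_one hL]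
    calc |(μ d : ℝ)| * lamR R d ≤ 1 * Real.log R := mul_le_mul hμ (lamR_le_log hR.le hd) (lamR_nonneg R d) zero_le_one
      _ = Real.log R := one_mul _

/-- `c_R(d) = 0` off the square-free numbers. [cite: GreenTaoAnnals2008, Definition 9.2] -/
theorem sharpCoef_eq_zero_of_not_squarefree (R : ℝ) {d : ℕ} (hd : ¬ Squarefree d) : sharpCoef R d = 0 := by
  unfold sharpCoef
  rw [ArithmeticFunction.moebius_eq_zero_of_not_squarefree hd]; simp

/-- `c_R(d) = 0` for `d > R ≥ 0`. [cite: GreenTaoAnnals2008, Definition 9.2] -/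
theorem sharpCoef_eq_zero_of_lt {R : ℝ} (hR : 0 ≤ R) {d : ℕ} (hd : R < d) : sharpCoef R d = 0 := by
  unfold sharpCoef
  have hd1 : 1 ≤ d := by
    rcases Nat.eq_zero_or_pos d with rfl | h
    · simp at hd; linarith
    · exact h
  rw [lamR_eq_zero hR hd1 hd.le]; simp

/-- **`Λ_R(n) = log R · ∑_{d ≤ R, d ∣ n} c_R(d)`** (`λ_R(d) = log(R/d)` for `d ≤ R`).
[cite: GreenTaoAnnals2008, Definition 9.2] -/
theorem truncatedDivisorSum_eq_mul_divSum {R : ℝ} (hR : 1 < R) (n : ℤ) :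
    truncatedDivisorSum R n = Real.log R * divSum (sharpCoef R) R n := by
  unfold truncatedDivisorSum divSum sharpCoef
  have hL : Real.log R ≠ 0 := (Real.log_pos hR).ne'
  rw [mul_sum]
  refine sum_congr rfl fun d hd => ?_
  obtain ⟨hd1, hdR⟩ := mem_Icc.1 (mem_filter.1 hd).1
  have hdR' : (d : ℝ) ≤ R := (Nat.cast_le.2 hdR).trans (Nat.floor_le (by linarith))
  rw [lamR_eq_log hd1 hdR']
  field_simp

/-- On tuples of square-free `P`-numbers, `∏_v c_R(dd_v) = (log R)^{-2m} (∏_v μ(dd_v)) ∏_v λ_R(dd_v)`.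
[cite: GreenTaoAnnals2008, Definition 9.2] -/
theorem prod_sharpCoef_eq {R : ℝ} (hR : 1 < R) (dd : Fin m ⊕ Fin m → ℕ) :
    ∏ v, sharpCoef R (dd v) = (Real.log R ^ (2 * m))⁻¹ * ((∏ v, (μ (dd v) : ℝ)) * ∏ v, lamR R (dd v)) := by
  unfold sharpCoef
  have hL : Real.log R ≠ 0 := (Real.log_pos hR).ne'
  simp only [div_eq_mul_inv]
  rw [prod_mul_distrib, prod_mul_distrib, prod_const, card_univ, Fintype.card_sum, Fintype.card_fin, ← two_mul,
    inv_pow]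
  ring

/-- **From the box average to the sharp tuple sum**:
`E_{x∈B} ∏_i Λ_R(θ_i(x))² = S(P) + (log R)^{2m} E₁` with `|E₁| ≤ R^{2m} ∑_j R^{2m}/ℓ_j`, for boxes with
sides `ℓ_j ≥ R^{2m}` and `P` the primes below some `Q > R` (expansion (10.1), the period error of the
paragraph before (10.2), and re-indexing by square-free tuples).
[cite: GreenTaoAnnals2008, Section 10 eq. 10.1 and 10.2] -/
theorem expect_prod_sq_eq_sharpTupleSum_add {R : ℝ} (hR : 1 < R) {Q : ℕ} (hQ : R < Q) (W : ℕ)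
    (L : Fin m → Fin t → ℤ) (b : Fin m → ℤ) (a : Fin t → ℤ) (ℓ : Fin t → ℕ) (hℓ : ∀ j, R ^ (2 * m) ≤ ℓ j) :
    ∃ E₁ : ℝ, |E₁| ≤ R ^ (2 * m) * ∑ j, R ^ (2 * m) / ℓ j ∧
      (𝔼 x ∈ Fintype.piFinset (fun j => Ico (a j) (a j + ℓ j)),
          ∏ i, truncatedDivisorSum R (wForm W (L i) (b i) x) ^ 2) =
        sharpTupleSum (Nat.primesBelow Q) W L b R + Real.log R ^ (2 * m) * E₁ := by
  classical
  set c := sharpCoef R with hc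
  set Bx := Fintype.piFinset (fun j => Ico (a j) (a j + ℓ j)) with hBx
  set P := Nat.primesBelow Q with hPdef
  have hP : ∀ p ∈ P, p.Prime := fun p hp => (Nat.mem_primesBelow.1 hp).2
  -- the expansion
  have hexp : (𝔼 x ∈ Bx, ∏ i, truncatedDivisorSum R (wForm W (L i) (b i) x) ^ 2) =
      Real.log R ^ (2 * m) * ∑ dd ∈ Fintype.piFinset (fun _ : Fin m ⊕ Fin m => Icc 1 ⌊R⌋₊),
        (∏ v, c (dd v)) * 𝔼 x ∈ Bx,
          (if ∀ j, ((dd (Sum.inl j) : ℤ) ∣ wForm W (L j) (b j) x) ∧ ((dd (Sum.inr j) : ℤ) ∣ wForm W (L j) (b j) x)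
            then (1 : ℝ) else 0) := by
    rw [← expect_prod_sq_divSum_eq c R (Real.log R) W L b Bx]
    refine expect_congr rfl fun x _ => prod_congr rfl fun i _ => ?_
    rw [truncatedDivisorSum_eq_mul_divSum hR]
  -- the period error
  set E₁ : ℝ := ∑ dd ∈ Fintype.piFinset (fun _ : Fin m ⊕ Fin m => Icc 1 ⌊R⌋₊),
      (∏ v, c (dd v)) * ((𝔼 x ∈ Bx,
        (if ∀ j, ((dd (Sum.inl j) : ℤ) ∣ wForm W (L j) (b j) x) ∧ ((dd (Sum.inr j) : ℤ) ∣ wForm W (L j) (b j) x)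
          then (1 : ℝ) else 0)) - tupleDensity W L b (fun j => dd (Sum.inl j)) (fun j => dd (Sum.inr j))) with hE₁
  have hE₁bd : |E₁| ≤ R ^ (2 * m) * ∑ j, R ^ (2 * m) / ℓ j :=
    abs_sum_coef_mul_expect_sub_tupleDensity_le c (abs_sharpCoef_le hR) (fun d hd => sharpCoef_eq_zero_of_not_squarefree R hd)
      hR.le W L b a ℓ hℓ
  -- re-indexing by square-free tuples
  have hmain : ∑ dd ∈ Fintype.piFinset (fun _ : Fin m ⊕ Fin m => Icc 1 ⌊R⌋₊),
      (∏ v, c (dd v)) * tupleDensity W L b (fun j => dd (Sum.inl j)) (fun j => dd (Sum.inr j)) =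
      (Real.log R ^ (2 * m))⁻¹ * sharpTupleSum P W L b R := by
    rw [sum_piFinset_eq_of_vanish (Icc 1 ⌊R⌋₊) (squarefreeOf P) _ ?_]
    · unfold sharpTupleSum
      rw [mul_sum]
      refine sum_congr rfl fun dd _ => ?_
      rw [prod_sharpCoef_eq hR]
      ring
    · -- vanishing off `[1,R] ∩ squarefreeOf P`
      rintro dd ⟨v, hv⟩
      have h0 : c (dd v) = 0 := by
        by_contra hne
        apply hv
        rw [mem_inter]
        have hsq : Squarefree (dd v) := by
          by_contra h; exact hne (sharpCoef_eq_zero_of_not_squarefree R h)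
        have hdR : (dd v : ℝ) ≤ R := by
          by_contra h; exact hne (sharpCoef_eq_zero_of_lt (by linarith) (not_le.1 h))
        have hd1 : 1 ≤ dd v := Nat.pos_of_ne_zero hsq.ne_zero
        refine ⟨mem_Icc.2 ⟨hd1, Nat.le_floor hdR⟩, (mem_squarefreeOf hP).2 ⟨hsq, fun p hp => ?_⟩⟩
        have hpp := Nat.prime_of_mem_primeFactors hp
        have hple : p ≤ dd v := Nat.le_of_dvd hd1 (Nat.dvd_of_mem_primeFactors hp)
        refine Nat.mem_primesBelow.2 ⟨?_, hpp⟩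
        have : (p : ℝ) < Q := ((Nat.cast_le.2 hple).trans hdR).trans_lt hQ
        exact_mod_cast this
      rw [prod_eq_zero (mem_univ v) h0, zero_mul]
  refine ⟨E₁, hE₁bd, ?_⟩
  rw [hexp]
  have hsplit : ∑ dd ∈ Fintype.piFinset (fun _ : Fin m ⊕ Fin m => Icc 1 ⌊R⌋₊),
      (∏ v, c (dd v)) * 𝔼 x ∈ Bx,
        (if ∀ j, ((dd (Sum.inl j) : ℤ) ∣ wForm W (L j) (b j) x) ∧ ((dd (Sum.inr j) : ℤ) ∣ wForm W (L j) (b j) x)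
          then (1 : ℝ) else 0) =
      (∑ dd ∈ Fintype.piFinset (fun _ : Fin m ⊕ Fin m => Icc 1 ⌊R⌋₊),
        (∏ v, c (dd v)) * tupleDensity W L b (fun j => dd (Sum.inl j)) (fun j => dd (Sum.inr j))) + E₁ := by
    rw [hE₁, ← sum_add_distrib]
    exact sum_congr rfl fun dd _ => by ring
  rw [hsplit, hmain, mul_add, ← mul_assoc, mul_inv_cancel₀ (pow_ne_zero _ (Real.log_pos hR).ne'), one_mul]

/-! ### The main term `S₁(W; R, R)/((W/φ(W)) log R) → 1` -/

/-- The bound `P₀(w, L) = 5^{w+1} exp(4 (w log 4 + L)/(log 2 · √w))` for the Rankin factors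
`Π_{We}(1/2)`, `W = w#`, `e ≤ R = e^L`. [folklore] -/
def rankinBound (w : ℕ) (L : ℝ) : ℝ :=
  5 ^ (w + 1) * Real.exp (4 * ((w * Real.log 4 + L) / Real.log 2) / Real.sqrt w)

/-- The Rankin cut `Y₀ = U P₀² e^{2√L}`. [folklore] -/
def cutY (U : ℝ) (w : ℕ) (L : ℝ) : ℝ := U * rankinBound w L ^ 2 * Real.exp (2 * Real.sqrt L)

/-- `P₀ ≥ 1`. [folklore] -/
theorem one_le_rankinBound (w : ℕ) {L : ℝ} (hL : 0 ≤ L) : 1 ≤ rankinBound w L := by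
  unfold rankinBound
  have h1 : (1 : ℝ) ≤ 5 ^ (w + 1) := one_le_pow₀ (by norm_num)
  have h2 : (1 : ℝ) ≤ Real.exp (4 * ((w * Real.log 4 + L) / Real.log 2) / Real.sqrt w) := by
    refine Real.one_le_exp ?_
    have : 0 ≤ (w : ℝ) * Real.log 4 + L := by positivity
    have : 0 < Real.log 2 := Real.log_pos (by norm_num)
    positivity
  nlinarith

/-- **`Π_{We}(1/2) ≤ P₀(w, log R)`** for `W = w#` (`w ≥ 1`) and `1 ≤ e ≤ R`
(`rankinProd_half_le` with `Z = w`; `ω(We) log 2 ≤ log(We) ≤ w log 4 + log R`).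
[folklore] -/
theorem rankinProd_primorial_mul_le {w : ℕ} (hw : 1 ≤ w) {R : ℝ} {e : ℕ} (he : 1 ≤ e)
    (heR : (e : ℝ) ≤ R) : rankinProd (1 / 2) (primorial w * e) ≤ rankinBound w (Real.log R) := by
  have hW0 : primorial w ≠ 0 := (primorial_pos w).ne'
  have hn0 : primorial w * e ≠ 0 := mul_ne_zero hW0 (by omega)
  refine (rankinProd_half_le (n := primorial w * e) hw).trans ?_
  unfold rankinBound
  refine mul_le_mul_of_nonneg_left (Real.exp_le_exp.2 ?_) (by positivity)
  have hsqrt : 0 < Real.sqrt w := Real.sqrt_pos.2 (by exact_mod_cast hw)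
  refine div_le_div_of_nonneg_right (mul_le_mul_of_nonneg_left ?_ (by norm_num)) hsqrt.le
  have hlog2 : 0 < Real.log 2 := Real.log_pos (by norm_num)
  rw [le_div_iff₀ hlog2]
  refine (card_primeFactors_mul_log_two_le hn0).trans ?_
  have hW : (primorial w : ℝ) ≤ 4 ^ w := by exact_mod_cast primorial_le_four_pow w
  have he0 : (0 : ℝ) < e := by exact_mod_cast he
  push_cast
  rw [Real.log_mul (by exact_mod_cast hW0) he0.ne']
  have h1 : Real.log (primorial w) ≤ w * Real.log 4 := by
    rw [← Real.log_pow]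
    exact Real.log_le_log (by exact_mod_cast primorial_pos w) (by exact_mod_cast primorial_le_four_pow w)
  have h2 : Real.log e ≤ Real.log R := Real.log_le_log he0 heR
  linarith

/-- The prime factors of `w#` are the primes `≤ w`; in particular there are at most `w + 1` of them.
[folklore] -/
theorem card_primeFactors_primorial_le (w : ℕ) : (primorial w).primeFactors.card ≤ w + 1 := by
  calc (primorial w).primeFactors.card ≤ (range (w + 1)).card := by
        refine card_le_card fun p hp => ?_
        have hpp := Nat.prime_of_mem_primeFactors hp
        have := (hpp.dvd_primorial_iff).1 (Nat.dvd_of_mem_primeFactors hp)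
        exact mem_range.2 (Nat.lt_succ_of_le this)
    _ = w + 1 := card_range _

/-- `W/φ(W) ≤ 2^{w+1}` for `W = w#`. [folklore] -/
theorem div_totient_primorial_le (w : ℕ) :
    (primorial w : ℝ) / ((primorial w).totient : ℝ) ≤ 2 ^ (w + 1) := by
  have hW0 : primorial w ≠ 0 := (primorial_pos w).ne'
  rw [div_totient_eq_rankinProd hW0]
  unfold rankinProd
  calc ∏ p ∈ (primorial w).primeFactors, (1 - (p : ℝ) ^ (-(1 : ℝ)))⁻¹
      ≤ ∏ _p ∈ (primorial w).primeFactors, (2 : ℝ) := by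
        refine prod_le_prod (fun p hp => zero_le_one.trans (one_le_rankinFactor (Nat.prime_of_mem_primeFactors hp) one_pos))
          fun p hp => ?_
        have hpp := Nat.prime_of_mem_primeFactors hp
        have hp2 : (2 : ℝ) ≤ p := by exact_mod_cast hpp.two_le
        rw [Real.rpow_neg (by positivity), Real.rpow_one]
        rw [inv_le_comm₀ (by rw [sub_pos]; exact inv_lt_one_of_one_lt₀ (by linarith)) two_pos]
        have : (p : ℝ)⁻¹ ≤ 1 / 2 := by rw [inv_eq_one_div]; exact one_div_le_one_div_of_le two_pos hp2
        linarith
    _ = 2 ^ (primorial w).primeFactors.card := prod_const _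
    _ ≤ 2 ^ (w + 1) := pow_le_pow_right₀ (by norm_num) (card_primeFactors_primorial_le w)

/-- `harmErr(w#) + 4 ≤ 13 w 4^w` (`w ≥ 1`): `τ(W) ≤ W ≤ 4^w`, `log W ≤ w log 4 ≤ 2w`. [folklore] -/
theorem harmErr_primorial_le {w : ℕ} (hw : 1 ≤ w) : harmErr (primorial w) + 4 ≤ 13 * w * 4 ^ w := by
  unfold harmErr
  have hW : (primorial w : ℝ) ≤ 4 ^ w := by exact_mod_cast primorial_le_four_pow w
  have hτ : ((primorial w).divisors.card : ℝ) ≤ 4 ^ w :=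
    le_trans (by exact_mod_cast Nat.card_divisors_le_self _) hW
  have hlog : Real.log (primorial w) ≤ 2 * w := by
    have h1 : Real.log (primorial w) ≤ w * Real.log 4 := by
      rw [← Real.log_pow]
      exact Real.log_le_log (by exact_mod_cast primorial_pos w) hW
    have h4 : Real.log 4 ≤ 2 := by
      have := Real.log_le_sub_one_of_pos (show (0:ℝ) < 4 by norm_num)
      rw [show (4:ℝ) = 2^2 by norm_num, Real.log_pow]; push_cast
      have h2 : Real.log 2 ≤ 1 := by
        have := Real.log_le_sub_one_of_pos (show (0:ℝ) < 2 by norm_num); linarith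
      linarith
    have hw0 : (0 : ℝ) ≤ w := Nat.cast_nonneg w
    nlinarith
  have hlog0 : 0 ≤ Real.log (primorial w) := Real.log_nonneg (by exact_mod_cast primorial_pos w)
  have hw1 : (1 : ℝ) ≤ w := by exact_mod_cast hw
  have h4w : (4 : ℝ) ≤ 4 ^ w := by
    calc (4 : ℝ) = 4 ^ 1 := (pow_one _).symm
      _ ≤ 4 ^ w := pow_le_pow_right₀ (by norm_num) hw
  nlinarith

/-- Product of three factors in `[0,1]`: `(1-x)(1-y)(1-z) ≥ 1 - x - y - z`. [folklore] -/
theorem one_sub_three_le {x y z : ℝ} (hx : 0 ≤ x) (hx1 : x ≤ 1) (hy : 0 ≤ y) (hz : 0 ≤ z) :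
    1 - x - y - z ≤ (1 - x) * (1 - y) * (1 - z) := by
  nlinarith [mul_nonneg hx hy, mul_nonneg (mul_nonneg hx hy) hz, mul_nonneg hx hz, mul_nonneg hy hz,
    mul_nonneg (sub_nonneg.2 hx1) (mul_nonneg hy hz)]

/-- From the tree's two-sided bound `|G - A⁻¹ log⌊x⌋| ≤ K₁ + A⁻¹ κ log⌊x⌋` to bounds for `A G` in terms of
upper/lower bounds `Y ≤ log⌊x⌋ ≤ X`. [folklore] -/
theorem mul_G_bounds {A G lg K₁ κ X Y : ℝ} (hA : 0 < A) (hκ0 : 0 ≤ κ) (hκ1 : κ ≤ 1)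
    (hGb : |G - A⁻¹ * lg| ≤ K₁ + A⁻¹ * κ * lg) (hX : lg ≤ X) (hY : Y ≤ lg) :
    A * G ≤ X * (1 + κ) + A * K₁ ∧ Y * (1 - κ) - A * K₁ ≤ A * G := by
  have hA' : A⁻¹ * A = 1 := inv_mul_cancel₀ hA.ne'
  obtain ⟨h1, h2⟩ := abs_le.1 hGb
  constructor
  · have h3 : A * G ≤ lg * (1 + κ) + A * K₁ := by
      have : A * G - lg ≤ A * K₁ + κ * lg := by
        have e : A * (G - A⁻¹ * lg) = A * G - lg := by field_simp
        have e' : A * (K₁ + A⁻¹ * κ * lg) = A * K₁ + κ * lg := by field_simp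
        rw [← e, ← e']
        exact mul_le_mul_of_nonneg_left h2 hA.le
      linarith
    have h4 : lg * (1 + κ) ≤ X * (1 + κ) := mul_le_mul_of_nonneg_right hX (by linarith)
    linarith
  · have h3 : lg * (1 - κ) - A * K₁ ≤ A * G := by
      have : -(A * K₁ + κ * lg) ≤ A * G - lg := by
        have e : A * (G - A⁻¹ * lg) = A * G - lg := by field_simp
        have e' : A * (K₁ + A⁻¹ * κ * lg) = A * K₁ + κ * lg := by field_simp
        rw [← e, ← e', ← mul_neg]
        exact mul_le_mul_of_nonneg_left h1 hA.le
      linarith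
    have h4 : Y * (1 - κ) ≤ lg * (1 - κ) := mul_le_mul_of_nonneg_right hY (by linarith)
    linarith

/-- Numerics of the main term: from `x ≤ (1+u)²(1+κ) + (1+u)² a + B²(2κ+ℓ+2a)` and
`(1-u)²((1-ℓ)(1-κ) - a) ≤ x` (`0 ≤ u ≤ 1/2`, `κ, ℓ ∈ [0,1]`, `a ≥ 0`) to
`|x - 1| ≤ 3u + 3κ + 3a + B²(2κ+ℓ+2a) + ℓ`. [folklore] -/
theorem numeric_abs_sub_one_le {x u κ a ℓ B : ℝ} (hu0 : 0 ≤ u) (hu1 : u ≤ 1 / 2) (hκ0 : 0 ≤ κ) (hκ1 : κ ≤ 1)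
    (ha0 : 0 ≤ a) (hℓ0 : 0 ≤ ℓ) (hℓ1 : ℓ ≤ 1)
    (hup : x ≤ (1 + u) ^ 2 * (1 + κ) + (1 + u) ^ 2 * a + B ^ 2 * (2 * κ + ℓ + 2 * a))
    (hlo : (1 - u) ^ 2 * ((1 - ℓ) * (1 - κ) - a) ≤ x) :
    |x - 1| ≤ 3 * u + 3 * κ + 3 * a + B ^ 2 * (2 * κ + ℓ + 2 * a) + ℓ := by
  have hB2 : 0 ≤ B ^ 2 := sq_nonneg _
  have hX : 0 ≤ 2 * κ + ℓ + 2 * a := by linarith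
  have hup' : x - 1 ≤ 3 * u + 3 * κ + 3 * a + B ^ 2 * (2 * κ + ℓ + 2 * a) := by
    have h1 : (1 + u) ^ 2 ≤ 1 + 3 * u := by nlinarith
    have h2 : (1 + u) ^ 2 * (1 + κ) ≤ (1 + 3 * u) * (1 + κ) := mul_le_mul_of_nonneg_right h1 (by linarith)
    have h2' : (1 + 3 * u) * (1 + κ) ≤ 1 + 3 * u + 3 * κ := by nlinarith
    have h3 : (1 + u) ^ 2 * a ≤ 3 * a := by nlinarith
    linarith
  have hlo' : 1 - x ≤ 2 * u + κ + ℓ + a := by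
    have h1 : 1 - 2 * u - κ - ℓ ≤ (1 - 2 * u) * (1 - κ) * (1 - ℓ) :=
      one_sub_three_le (by linarith) (by linarith) hκ0 hℓ0
    have hprod : 0 ≤ (1 - ℓ) * (1 - κ) := mul_nonneg (by linarith) (by linarith)
    have hsq : 1 - 2 * u ≤ (1 - u) ^ 2 := by nlinarith
    have hsq1 : (1 - u) ^ 2 ≤ 1 := by nlinarith
    have t1 : (1 - 2 * u) * ((1 - ℓ) * (1 - κ)) ≤ (1 - u) ^ 2 * ((1 - ℓ) * (1 - κ)) :=
      mul_le_mul_of_nonneg_right hsq hprod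
    have t2 : (1 - u) ^ 2 * a ≤ a := by nlinarith
    have e : (1 - 2 * u) * (1 - κ) * (1 - ℓ) = (1 - 2 * u) * ((1 - ℓ) * (1 - κ)) := by ring
    have e' : (1 - u) ^ 2 * ((1 - ℓ) * (1 - κ) - a) = (1 - u) ^ 2 * ((1 - ℓ) * (1 - κ)) - (1 - u) ^ 2 * a := by ring
    linarith
  have hmul : 0 ≤ B ^ 2 * (2 * κ + ℓ + 2 * a) := mul_nonneg hB2 hX
  rw [abs_le]
  constructor <;> linarith

/-- Upper bound for the main term in multiplied-out form. [folklore] -/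
theorem main_upper_mul {A L LY κ K₁ G₁ G₂ B u : ℝ} (hA1 : 1 ≤ A) (hL : 0 < L) (hLY : 0 ≤ LY)
    (hκ0 : 0 ≤ κ)
    (hG₁u : A * G₁ ≤ (L - LY) * (1 + κ) + A * K₁) (hG₁l : (L - LY - 1) * (1 - κ) - A * K₁ ≤ A * G₁)
    (hG₂u : A * G₂ ≤ L * (1 + κ) + A * K₁) :
    A ^ 2 * ((1 + u) ^ 2 * G₁ + B ^ 2 * (G₂ - G₁)) ≤
      ((1 + u) ^ 2 * (1 + κ) + (1 + u) ^ 2 * (A * K₁ / L) + B ^ 2 * (2 * κ + (LY + 1) / L + 2 * (A * K₁ / L))) * (A * L) := by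
  have hA0 : 0 < A := by linarith
  -- `A² G₁ ≤ A L (1+κ) + A² K₁`
  have h1 : A * (A * G₁) ≤ (1 + κ) * (A * L) + A * (A * K₁) := by
    have t := mul_le_mul_of_nonneg_left hG₁u hA0.le
    have t2 : A * ((L - LY) * (1 + κ)) ≤ (1 + κ) * (A * L) := by
      have : (L - LY) * (1 + κ) ≤ L * (1 + κ) := mul_le_mul_of_nonneg_right (by linarith) (by linarith)
      nlinarith
    nlinarith
  -- `A² (G₂ - G₁) ≤ 2κ A L + A (LY + 1) + 2 A² K₁`
  have h2 : A * (A * G₂) - A * (A * G₁) ≤ 2 * κ * (A * L) + A * (LY + 1) + 2 * (A * (A * K₁)) := by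
    have t1 := mul_le_mul_of_nonneg_left hG₂u hA0.le
    have t2 := mul_le_mul_of_nonneg_left hG₁l hA0.le
    have e : A * (L * (1 + κ) + A * K₁) - A * ((L - LY - 1) * (1 - κ) - A * K₁) =
        2 * κ * (A * L) + A * ((LY + 1) * (1 - κ)) + 2 * (A * (A * K₁)) := by ring
    have t3 : A * ((LY + 1) * (1 - κ)) ≤ A * (LY + 1) := by
      have : (LY + 1) * (1 - κ) ≤ LY + 1 := by nlinarith
      exact mul_le_mul_of_nonneg_left this hA0.le
    linarith
  have hsq : 0 ≤ (1 + u) ^ 2 := sq_nonneg _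
  have hB2 : 0 ≤ B ^ 2 := sq_nonneg _
  have e : A ^ 2 * ((1 + u) ^ 2 * G₁ + B ^ 2 * (G₂ - G₁)) = (1 + u) ^ 2 * (A * (A * G₁)) + B ^ 2 * (A * (A * G₂) - A * (A * G₁)) := by
    ring
  have e' : ((1 + u) ^ 2 * (1 + κ) + (1 + u) ^ 2 * (A * K₁ / L) + B ^ 2 * (2 * κ + (LY + 1) / L + 2 * (A * K₁ / L))) * (A * L) =
      (1 + u) ^ 2 * ((1 + κ) * (A * L) + A * (A * K₁)) + B ^ 2 * (2 * κ * (A * L) + A * (LY + 1) + 2 * (A * (A * K₁))) := by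
    field_simp
  rw [e, e']
  have t1 := mul_le_mul_of_nonneg_left h1 hsq
  have t2 := mul_le_mul_of_nonneg_left h2 hB2
  linarith

/-- Lower bound for the main term in multiplied-out form. [folklore] -/
theorem main_lower_mul {A L LY κ K₁ G₁ u : ℝ} (hA1 : 1 ≤ A) (hL : 0 < L)
    (hG₁l : (L - LY - 1) * (1 - κ) - A * K₁ ≤ A * G₁) :
    ((1 - u) ^ 2 * ((1 - (LY + 1) / L) * (1 - κ) - A * K₁ / L)) * (A * L) ≤ A ^ 2 * ((1 - u) ^ 2 * G₁) := by
  have hA0 : 0 < A := by linarith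
  have hsq : 0 ≤ (1 - u) ^ 2 := sq_nonneg _
  have e : ((1 - u) ^ 2 * ((1 - (LY + 1) / L) * (1 - κ) - A * K₁ / L)) * (A * L) =
      (1 - u) ^ 2 * (A * ((L - LY - 1) * (1 - κ) - A * K₁)) := by
    field_simp
    ring
  have e' : A ^ 2 * ((1 - u) ^ 2 * G₁) = (1 - u) ^ 2 * (A * (A * G₁)) := by ring
  rw [e, e']
  exact mul_le_mul_of_nonneg_left (mul_le_mul_of_nonneg_left hG₁l hA0.le) hsq

/-- **The main term, algebraic core**: the bounds for `A G₁`, `A G₂` and the two-sided bounds for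
`D = S₁(W;R,R)` give `|D/(AL) - 1| ≤ 3u + 3κ + 3a + B²(2κ + ℓ + 2a) + ℓ` (`a = AK₁/L`, `ℓ = (LY+1)/L`).
[folklore] -/
theorem abs_div_sub_one_le_of_bounds {A L LY κ K₁ G₁ G₂ D B u : ℝ} (hA1 : 1 ≤ A) (hL : 0 < L) (hLY : 0 ≤ LY)
    (hκ0 : 0 ≤ κ) (hκ1 : κ ≤ 1) (hK₁ : 0 ≤ K₁) (hu0 : 0 ≤ u) (hu1 : u ≤ 1 / 2) (hLYL : LY + 1 ≤ L)
    (hG₁u : A * G₁ ≤ (L - LY) * (1 + κ) + A * K₁) (hG₁l : (L - LY - 1) * (1 - κ) - A * K₁ ≤ A * G₁)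
    (hG₂u : A * G₂ ≤ L * (1 + κ) + A * K₁)
    (hDu : D ≤ A ^ 2 * ((1 + u) ^ 2 * G₁ + B ^ 2 * (G₂ - G₁))) (hDl : A ^ 2 * ((1 - u) ^ 2 * G₁) ≤ D) :
    |D / (A * L) - 1| ≤ 3 * u + 3 * κ + 3 * (A * K₁ / L) + B ^ 2 * (2 * κ + (LY + 1) / L + 2 * (A * K₁ / L)) +
      (LY + 1) / L := by
  have hA0 : 0 < A := by linarith
  have hAL : 0 < A * L := mul_pos hA0 hL
  have hup : D / (A * L) ≤ (1 + u) ^ 2 * (1 + κ) + (1 + u) ^ 2 * (A * K₁ / L) +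
      B ^ 2 * (2 * κ + (LY + 1) / L + 2 * (A * K₁ / L)) := by
    rw [div_le_iff₀ hAL]
    exact hDu.trans (main_upper_mul hA1 hL hLY hκ0 hG₁u hG₁l hG₂u)
  have hlo : (1 - u) ^ 2 * ((1 - (LY + 1) / L) * (1 - κ) - A * K₁ / L) ≤ D / (A * L) := by
    rw [le_div_iff₀ hAL]
    exact (main_lower_mul hA1 hL hG₁l).trans hDl
  have ha0 : 0 ≤ A * K₁ / L := by positivity
  have hℓ0 : 0 ≤ (LY + 1) / L := by positivity
  have hℓ1 : (LY + 1) / L ≤ 1 := by rw [div_le_one hL]; exact hLYL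
  exact numeric_abs_sub_one_le hu0 hu1 hκ0 hκ1 ha0 hℓ0 hℓ1 hup hlo

/-- **The main term, deterministic form.** Let `|M| ≤ B`, `|M(u) - 1| ≤ η` for `u ≥ U ≥ 1`,
`W = w#` (`w ≥ 1`), `L = log R`, `P₀ = rankinBound w L`, `Y₀ = U P₀² e^{2√L}`,
`η' = η + (B+3) e^{-√L} ≤ 1/2`, `κ = bConst 2 · w^{-1/4} ≤ 1`, `K₁ = (harmErr W + 4) bConst 2`,
`log Y₀ + 1 ≤ L`. Then, with `A = W/φ(W)`,
`|S₁(W;R,R)/(A L) - 1| ≤ 3η' + 3κ + 3 A K₁/L + B²(2κ + (log Y₀+1)/L + 2 A K₁/L) + (log Y₀+1)/L`.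
[cite: GreenTaoAnnals2008, Lemma 10.3 and Appendix A Lemma A.3] -/
theorem abs_diagSum_div_sub_one_le {B η U : ℝ} (hB : ∀ y, |moebLog y| ≤ B) (hU : 1 ≤ U) (hη : 0 ≤ η)
    (hMU : ∀ u : ℝ, U ≤ u → |moebLog u - 1| ≤ η) {w : ℕ} (hw : 1 ≤ w) {R : ℝ} (hR : 1 < R)
    (hκ : bConst 2 * (w : ℝ) ^ (-(1 : ℝ) / 4) ≤ 1)
    (hη' : η + (B + 3) * Real.exp (-Real.sqrt (Real.log R)) ≤ 1 / 2)
    (hℓ : Real.log (cutY U w (Real.log R)) + 1 ≤ Real.log R) :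
    |diagSum (primorial w) R R / ((primorial w : ℝ) / ((primorial w).totient : ℝ) * Real.log R) - 1| ≤
      3 * (η + (B + 3) * Real.exp (-Real.sqrt (Real.log R))) + 3 * (bConst 2 * (w : ℝ) ^ (-(1 : ℝ) / 4)) +
        3 * ((primorial w : ℝ) / ((primorial w).totient : ℝ) * ((harmErr (primorial w) + 4) * bConst 2) / Real.log R) +
        B ^ 2 * (2 * (bConst 2 * (w : ℝ) ^ (-(1 : ℝ) / 4)) + (Real.log (cutY U w (Real.log R)) + 1) / Real.log R +
          2 * ((primorial w : ℝ) / ((primorial w).totient : ℝ) * ((harmErr (primorial w) + 4) * bConst 2) / Real.log R)) +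
        (Real.log (cutY U w (Real.log R)) + 1) / Real.log R := by
  have hW0 : primorial w ≠ 0 := (primorial_pos w).ne'
  have hL0 : 0 < Real.log R := Real.log_pos hR
  have hR0 : 0 < R := by linarith
  have hB0 : 0 ≤ B := (abs_nonneg _).trans (hB 0)
  have hA1 : 1 ≤ (primorial w : ℝ) / ((primorial w).totient : ℝ) := one_le_div_totient hW0
  have hP₀1 : 1 ≤ rankinBound w (Real.log R) := one_le_rankinBound w hL0.le
  -- `Y₀ ≥ U ≥ 1`
  have hY₀U : U ≤ cutY U w (Real.log R) := by
    unfold cutY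
    have h1 : 1 ≤ rankinBound w (Real.log R) ^ 2 * Real.exp (2 * Real.sqrt (Real.log R)) :=
      one_le_mul_of_one_le_of_one_le (one_le_pow₀ hP₀1) (Real.one_le_exp (by positivity))
    have hU0 : 0 ≤ U := by linarith
    calc U = U * 1 := (mul_one U).symm
      _ ≤ U * (rankinBound w (Real.log R) ^ 2 * Real.exp (2 * Real.sqrt (Real.log R))) := mul_le_mul_of_nonneg_left h1 hU0
      _ = _ := by ring
  have hY₀1 : 1 ≤ cutY U w (Real.log R) := hU.trans hY₀U
  have hY₀0 : 0 < cutY U w (Real.log R) := by linarith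
  have hLY0 : 0 ≤ Real.log (cutY U w (Real.log R)) := Real.log_nonneg hY₀1
  -- `hρ` with `η' = η + (B+3) e^{-√L}`
  have hρ : ∀ e : ℕ, e ≠ 0 → e.Coprime (primorial w) → (e : ℝ) * cutY U w (Real.log R) ≤ R →
      |rho (primorial w) R e - 1| ≤ η + (B + 3) * Real.exp (-Real.sqrt (Real.log R)) := by
    intro e he _ heR
    have he1 : 1 ≤ e := Nat.pos_of_ne_zero he
    have heR' : (e : ℝ) ≤ R := by
      calc (e : ℝ) = e * 1 := (mul_one _).symm
        _ ≤ e * cutY U w (Real.log R) := mul_le_mul_of_nonneg_left hY₀1 (Nat.cast_nonneg e)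
        _ ≤ R := heR
    have hPe : rankinProd (1 / 2) (primorial w * e) ≤ rankinBound w (Real.log R) :=
      rankinProd_primorial_mul_le hw he1 heR'
    have h := abs_rho_sub_one_le hB hU hη hMU hY₀U hW0 he heR hPe
    refine h.trans (le_of_eq ?_)
    congr 1
    -- `(B+3) (U/Y₀)^{1/2} P₀ = (B+3) e^{-√L}`
    set P₀ := rankinBound w (Real.log R) with hP₀
    set s := Real.sqrt (Real.log R) with hs
    have hP0 : 0 < P₀ := by linarith
    have hU0 : 0 < U := by linarith
    have hUY : U / cutY U w (Real.log R) = ((P₀ * Real.exp s)⁻¹) ^ (2 : ℝ) := by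
      unfold cutY
      rw [← hP₀, ← hs, Real.rpow_two]
      rw [show (2 : ℝ) * s = s + s by ring, Real.exp_add]
      field_simp
    rw [hUY, ← Real.rpow_mul (by positivity)]
    norm_num
    rw [Real.exp_neg]
    field_simp
  have hupper := diagSum_main_upper (Y₀ := cutY U w (Real.log R)) hB hW0 hY₀1 hR0.le hρ
  have hlower := diagSum_main_lower (Y₀ := cutY U w (Real.log R)) hB hW0 (by linarith) hY₀1 hR0.le hρ
  -- the `G_W` values
  have hD : ∀ p, p.Prime → p ≤ w → p ∣ primorial w := fun p hp hpw => (hp.dvd_primorial_iff).2 hpw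
  have hx₁ : 1 ≤ R / cutY U w (Real.log R) := by
    rw [le_div_iff₀ hY₀0, one_mul]
    exact (Real.log_le_log_iff hY₀0 hR0).1 (by linarith)
  have hGb₁ := abs_invTotSum_sub_le hW0 hw hD hx₁
  have hGb₂ := abs_invTotSum_sub_le hW0 hw hD hR.le
  obtain ⟨hfl₁, hfl₁'⟩ := log_floor_bounds hx₁
  obtain ⟨hfl₂, _⟩ := log_floor_bounds hR.le
  have hlogx₁ : Real.log (R / cutY U w (Real.log R)) = Real.log R - Real.log (cutY U w (Real.log R)) :=
    Real.log_div hR0.ne' hY₀0.ne'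
  have hAinv : ((primorial w).totient : ℝ) / (primorial w) = ((primorial w : ℝ) / ((primorial w).totient : ℝ))⁻¹ := by
    rw [inv_div]
  rw [hAinv] at hGb₁ hGb₂
  have hA0 : 0 < (primorial w : ℝ) / ((primorial w).totient : ℝ) := by linarith
  have hκ0 : 0 ≤ bConst 2 * (w : ℝ) ^ (-(1 : ℝ) / 4) := by
    have := one_le_bConst (show (0:ℝ) ≤ 2 by norm_num); positivity
  have hlg₁ : 0 ≤ Real.log ⌊R / cutY U w (Real.log R)⌋₊ := by
    have : (1:ℝ) ≤ ⌊R / cutY U w (Real.log R)⌋₊ := by exact_mod_cast Nat.le_floor (by simpa using hx₁)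
    exact Real.log_nonneg this
  have hlg₂ : 0 ≤ Real.log ⌊R⌋₊ := by
    have : (1:ℝ) ≤ ⌊R⌋₊ := by exact_mod_cast Nat.le_floor (by simpa using hR.le)
    exact Real.log_nonneg this
  have hGb₁' : |invTotSum (primorial w) (R / cutY U w (Real.log R)) -
      ((primorial w : ℝ) / ((primorial w).totient : ℝ))⁻¹ * Real.log ⌊R / cutY U w (Real.log R)⌋₊| ≤
      (harmErr (primorial w) + 4) * bConst 2 +
        ((primorial w : ℝ) / ((primorial w).totient : ℝ))⁻¹ * (bConst 2 * (w : ℝ) ^ (-(1 : ℝ) / 4)) *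
          Real.log ⌊R / cutY U w (Real.log R)⌋₊ := hGb₁
  obtain ⟨hAG₁u, hAG₁l⟩ := mul_G_bounds hA0 hκ0 hκ hGb₁' (hfl₁.trans (le_of_eq hlogx₁))
    (Y := Real.log R - Real.log (cutY U w (Real.log R)) - 1) (by linarith)
  obtain ⟨hAG₂u, _⟩ := mul_G_bounds hA0 hκ0 hκ hGb₂ hfl₂ (Y := 0) hlg₂
  have hK₁0 : 0 ≤ (harmErr (primorial w) + 4) * bConst 2 := by
    have := harmErr_nonneg (primorial w); have := one_le_bConst (show (0:ℝ) ≤ 2 by norm_num); positivity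
  have hu0 : 0 ≤ η + (B + 3) * Real.exp (-Real.sqrt (Real.log R)) := by positivity
  exact abs_div_sub_one_le_of_bounds hA1 hL0 hLY0 hκ0 hκ hK₁0 hu0 hη' hℓ hAG₁u hAG₁l hAG₂u hupper hlower


/-! ### The error budget as `3η + g(L) + f(w)` and the thresholds -/

/-- The `w`-part of the error budget (`→ 0` as `w → ∞`). [folklore] -/
def ffun (B : ℝ) (w : ℕ) : ℝ :=
  (3 + 2 * B ^ 2) * (bConst 2 * (w : ℝ) ^ (-(1 : ℝ) / 4) + bConst 2 * (26 * (w : ℝ) / 8 ^ w)) +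
    (B ^ 2 + 2) * ((2 * Real.log 5 + 8 * Real.log 4 / Real.log 2) * (((w : ℝ) + 1) / 64 ^ w) +
      8 / Real.log 2 * (Real.sqrt w)⁻¹)

/-- The `L`-part of the error budget (`→ 0` as `L = log R → ∞`). [folklore] -/
def gfun (B U L : ℝ) : ℝ :=
  3 * ((B + 3) * Real.exp (-Real.sqrt L)) + (B ^ 2 + 2) * ((Real.log U + 1) / L + 2 * (Real.sqrt L)⁻¹)

/-- `log Y₀ = log U + 2((w+1) log 5 + 4 (w log 4 + L)/(log 2 √w)) + 2√L`. [folklore] -/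
theorem log_cutY {U : ℝ} (hU : 0 < U) (w : ℕ) (L : ℝ) :
    Real.log (cutY U w L) = Real.log U + 2 * (((w : ℝ) + 1) * Real.log 5 +
      4 * (((w : ℝ) * Real.log 4 + L) / Real.log 2) / Real.sqrt w) + 2 * Real.sqrt L := by
  unfold cutY rankinBound
  have h5 : (0 : ℝ) < 5 ^ (w + 1) := by positivity
  have hex : 0 < Real.exp (4 * (((w : ℝ) * Real.log 4 + L) / Real.log 2) / Real.sqrt w) := Real.exp_pos _
  rw [Real.log_mul (by positivity) (Real.exp_pos _).ne', Real.log_mul hU.ne' (by positivity), Real.log_pow,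
    Real.log_mul h5.ne' hex.ne', Real.log_exp, Real.log_exp, Real.log_pow]
  push_cast
  ring

/-- `Y₀ ≥ 1` (indeed `≥ U`). [folklore] -/
theorem one_le_cutY {U : ℝ} (hU : 1 ≤ U) (w : ℕ) {L : ℝ} (hL : 0 ≤ L) : U ≤ cutY U w L ∧ 1 ≤ cutY U w L := by
  have hP := one_le_rankinBound w hL
  have h1 : 1 ≤ rankinBound w L ^ 2 * Real.exp (2 * Real.sqrt L) :=
    one_le_mul_of_one_le_of_one_le (one_le_pow₀ hP) (Real.one_le_exp (by positivity))
  have hU0 : 0 ≤ U := by linarith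
  have : U ≤ cutY U w L := by
    unfold cutY
    calc U = U * 1 := (mul_one U).symm
      _ ≤ U * (rankinBound w L ^ 2 * Real.exp (2 * Real.sqrt L)) := mul_le_mul_of_nonneg_left h1 hU0
      _ = _ := by ring
  exact ⟨this, hU.trans this⟩

/-- **`A K₁/L ≤ bConst 2 · 26 w/8^w`** for `W = w#`, `64^w ≤ L` (`A ≤ 2^{w+1}`, `K₁ ≤ 13 w 4^w bConst 2`).
[folklore] -/
theorem aterm_le {w : ℕ} (hw : 1 ≤ w) {L : ℝ} (hL : 0 < L) (hcoup : (64 : ℝ) ^ w ≤ L) :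
    (primorial w : ℝ) / ((primorial w).totient : ℝ) * ((harmErr (primorial w) + 4) * bConst 2) / L ≤
      bConst 2 * (26 * (w : ℝ) / 8 ^ w) := by
  have hbc : 1 ≤ bConst 2 := one_le_bConst (by norm_num)
  have hA2 : (primorial w : ℝ) / ((primorial w).totient : ℝ) ≤ 2 ^ (w + 1) := div_totient_primorial_le w
  have hK₁0 : 0 ≤ (harmErr (primorial w) + 4) * bConst 2 := by have := harmErr_nonneg (primorial w); positivity
  have hK : (harmErr (primorial w) + 4) * bConst 2 ≤ 13 * w * 4 ^ w * bConst 2 :=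
    mul_le_mul_of_nonneg_right (harmErr_primorial_le hw) (by linarith)
  have hAK : (primorial w : ℝ) / ((primorial w).totient : ℝ) * ((harmErr (primorial w) + 4) * bConst 2) ≤
      2 ^ (w + 1) * (13 * w * 4 ^ w * bConst 2) := mul_le_mul hA2 hK hK₁0 (by positivity)
  rw [div_le_iff₀ hL]
  refine hAK.trans ?_
  have e : bConst 2 * (26 * (w : ℝ) / 8 ^ w) * (64 : ℝ) ^ w = 2 ^ (w + 1) * (13 * w * 4 ^ w * bConst 2) := by
    rw [show (64 : ℝ) = 8 * 8 by norm_num, mul_pow, show (8 : ℝ) = 2 * 4 by norm_num, mul_pow, pow_succ]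
    field_simp
    ring
  calc 2 ^ (w + 1) * (13 * (w : ℝ) * 4 ^ w * bConst 2) = bConst 2 * (26 * (w : ℝ) / 8 ^ w) * (64 : ℝ) ^ w := e.symm
    _ ≤ bConst 2 * (26 * (w : ℝ) / 8 ^ w) * L := mul_le_mul_of_nonneg_left hcoup (by positivity)

/-- **`(log Y₀ + 1)/L ≤ (log U + 1)/L + 2/√L + c₅ (w+1)/64^w + (8/log 2)/√w`** for `64^w ≤ L`, `w ≥ 1`
(`c₅ = 2 log 5 + 8 log 4/log 2`). [folklore] -/
theorem ellterm_le {U : ℝ} (hU : 1 ≤ U) {w : ℕ} (hw : 1 ≤ w) {L : ℝ} (hL : 0 < L) (hcoup : (64 : ℝ) ^ w ≤ L) :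
    (Real.log (cutY U w L) + 1) / L ≤ (Real.log U + 1) / L + 2 * (Real.sqrt L)⁻¹ +
      ((2 * Real.log 5 + 8 * Real.log 4 / Real.log 2) * (((w : ℝ) + 1) / 64 ^ w) + 8 / Real.log 2 * (Real.sqrt w)⁻¹) := by
  have hU0 : 0 < U := by linarith
  have hw1 : (1 : ℝ) ≤ w := by exact_mod_cast hw
  have hlog2 : 0 < Real.log 2 := Real.log_pos (by norm_num)
  have hlog4 : 0 < Real.log 4 := Real.log_pos (by norm_num)
  have hlog5 : 0 < Real.log 5 := Real.log_pos (by norm_num)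
  have hsw : 0 < Real.sqrt w := Real.sqrt_pos.2 (by linarith)
  have h64 : (1 : ℝ) ≤ 64 ^ w := one_le_pow₀ (by norm_num)
  have hsL : 0 < Real.sqrt L := Real.sqrt_pos.2 hL
  have hsL2 : Real.sqrt L * Real.sqrt L = L := Real.mul_self_sqrt hL.le
  rw [log_cutY hU0 w L]
  have t1 : (2 * Real.sqrt L) / L = 2 * (Real.sqrt L)⁻¹ := by
    field_simp; nlinarith [hsL2]
  have t2 : 2 * (((w : ℝ) + 1) * Real.log 5) / L ≤ 2 * Real.log 5 * (((w : ℝ) + 1) / 64 ^ w) := by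
    have hnum : 0 ≤ 2 * (((w : ℝ) + 1) * Real.log 5) := by positivity
    calc 2 * (((w : ℝ) + 1) * Real.log 5) / L ≤ 2 * (((w : ℝ) + 1) * Real.log 5) / 64 ^ w :=
          div_le_div_of_nonneg_left hnum (by positivity) hcoup
      _ = 2 * Real.log 5 * (((w : ℝ) + 1) / 64 ^ w) := by ring
  have t3 : 2 * (4 * (((w : ℝ) * Real.log 4 + L) / Real.log 2) / Real.sqrt w) / L ≤
      8 * Real.log 4 / Real.log 2 * (((w : ℝ) + 1) / 64 ^ w) + 8 / Real.log 2 * (Real.sqrt w)⁻¹ := by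
    have e : 2 * (4 * (((w : ℝ) * Real.log 4 + L) / Real.log 2) / Real.sqrt w) / L =
        8 * Real.log 4 / Real.log 2 * ((w : ℝ) / (Real.sqrt w * L)) + 8 / Real.log 2 * (Real.sqrt w)⁻¹ := by
      field_simp
      ring
    rw [e]
    have hsub : (w : ℝ) / (Real.sqrt w * L) ≤ ((w : ℝ) + 1) / 64 ^ w := by
      have hsw1 : 1 ≤ Real.sqrt w := by rw [show (1:ℝ) = Real.sqrt 1 by simp]; exact Real.sqrt_le_sqrt hw1
      rw [div_le_div_iff₀ (by positivity) (by positivity)]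
      calc (w : ℝ) * 64 ^ w ≤ ((w : ℝ) + 1) * (1 * 64 ^ w) := by nlinarith [h64]
        _ ≤ ((w : ℝ) + 1) * (Real.sqrt w * L) := by
            refine mul_le_mul_of_nonneg_left ?_ (by positivity)
            exact mul_le_mul hsw1 hcoup (by positivity) (by positivity)
    have hc : 0 ≤ 8 * Real.log 4 / Real.log 2 := by positivity
    linarith [mul_le_mul_of_nonneg_left hsub hc]
  have hsum : (Real.log U + 2 * (((w : ℝ) + 1) * Real.log 5 + 4 * (((w : ℝ) * Real.log 4 + L) / Real.log 2) / Real.sqrt w) +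
      2 * Real.sqrt L + 1) / L =
      (Real.log U + 1) / L + (2 * Real.sqrt L) / L + 2 * (((w : ℝ) + 1) * Real.log 5) / L +
        2 * (4 * (((w : ℝ) * Real.log 4 + L) / Real.log 2) / Real.sqrt w) / L := by
    field_simp; ring
  rw [hsum, t1]
  linarith

/-- **The error budget**: for `w ≥ 1`, `64^w ≤ L = log R`, `U ≥ 1`, the right-hand side of
`abs_diagSum_div_sub_one_le` is at most `3η + g(L) + f(w)`. [folklore] -/
theorem budget_le {B η U : ℝ} (hU : 1 ≤ U) {w : ℕ} (hw : 1 ≤ w) {R : ℝ} (hR : 1 < R)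
    (hcoup : (64 : ℝ) ^ w ≤ Real.log R) :
    3 * (η + (B + 3) * Real.exp (-Real.sqrt (Real.log R))) + 3 * (bConst 2 * (w : ℝ) ^ (-(1 : ℝ) / 4)) +
        3 * ((primorial w : ℝ) / ((primorial w).totient : ℝ) * ((harmErr (primorial w) + 4) * bConst 2) / Real.log R) +
        B ^ 2 * (2 * (bConst 2 * (w : ℝ) ^ (-(1 : ℝ) / 4)) + (Real.log (cutY U w (Real.log R)) + 1) / Real.log R +
          2 * ((primorial w : ℝ) / ((primorial w).totient : ℝ) * ((harmErr (primorial w) + 4) * bConst 2) / Real.log R)) +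
        (Real.log (cutY U w (Real.log R)) + 1) / Real.log R ≤
      3 * η + gfun B U (Real.log R) + ffun B w := by
  have hL0 : 0 < Real.log R := Real.log_pos hR
  have ha := aterm_le hw hL0 hcoup
  have hℓ := ellterm_le hU hw hL0 hcoup
  have hB2 : 0 ≤ B ^ 2 := sq_nonneg _
  have hℓ0 : 0 ≤ (Real.log (cutY U w (Real.log R)) + 1) / Real.log R := by
    have := Real.log_nonneg (one_le_cutY hU w hL0.le).2
    positivity
  have hU' : 0 ≤ (Real.log U + 1) / Real.log R + 2 * (Real.sqrt (Real.log R))⁻¹ := by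
    have := Real.log_nonneg hU; positivity
  unfold ffun gfun
  generalize (Real.log (cutY U w (Real.log R)) + 1) / Real.log R = ℓ at hℓ hℓ0 ⊢
  generalize (primorial w : ℝ) / ((primorial w).totient : ℝ) * ((harmErr (primorial w) + 4) * bConst 2) / Real.log R = a at ha ⊢
  generalize bConst 2 * (w : ℝ) ^ (-(1 : ℝ) / 4) = κ
  generalize (B + 3) * Real.exp (-Real.sqrt (Real.log R)) = E
  generalize (Real.log U + 1) / Real.log R + 2 * (Real.sqrt (Real.log R))⁻¹ = ℓL at hℓ hU' ⊢
  generalize (2 * Real.log 5 + 8 * Real.log 4 / Real.log 2) * (((w : ℝ) + 1) / 64 ^ w) + 8 / Real.log 2 * (Real.sqrt w)⁻¹ = ℓw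
    at hℓ ⊢
  generalize bConst 2 * (26 * (w : ℝ) / 8 ^ w) = a' at ha ⊢
  have t1 := mul_le_mul_of_nonneg_left hℓ hB2
  have t2 := mul_le_mul_of_nonneg_left ha hB2
  nlinarith [t1, t2, hℓ0, mul_nonneg hB2 hℓ0]

/-- `f(w) → 0`. [folklore] -/
theorem tendsto_ffun (B : ℝ) : Tendsto (fun w : ℕ => ffun B w) atTop (𝓝 0) := by
  have h1 : Tendsto (fun w : ℕ => (w : ℝ) ^ (-(1 : ℝ) / 4)) atTop (𝓝 0) := by
    have := (tendsto_rpow_neg_atTop (show (0 : ℝ) < 1 / 4 by norm_num)).comp (tendsto_natCast_atTop_atTop (R := ℝ))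
    refine this.congr fun w => ?_
    simp only [Function.comp]; norm_num
  have h2 : Tendsto (fun w : ℕ => 26 * (w : ℝ) / 8 ^ w) atTop (𝓝 0) := by
    have := (tendsto_pow_const_div_const_pow_of_one_lt 1 (show (1 : ℝ) < 8 by norm_num)).const_mul 26
    rw [mul_zero] at this
    refine this.congr fun w => ?_
    ring
  have h3 : Tendsto (fun w : ℕ => ((w : ℝ) + 1) / 64 ^ w) atTop (𝓝 0) := by
    have ha := tendsto_pow_const_div_const_pow_of_one_lt 1 (show (1 : ℝ) < 64 by norm_num)
    have hb := tendsto_pow_const_div_const_pow_of_one_lt 0 (show (1 : ℝ) < 64 by norm_num)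
    have := ha.add hb
    rw [add_zero] at this
    refine this.congr fun w => ?_
    simp only [pow_one, pow_zero]
    ring
  have h4 : Tendsto (fun w : ℕ => (Real.sqrt w)⁻¹) atTop (𝓝 0) :=
    tendsto_inv_atTop_zero.comp (Real.tendsto_sqrt_atTop.comp (tendsto_natCast_atTop_atTop (R := ℝ)))
  have := (((h1.const_mul (bConst 2)).add (h2.const_mul (bConst 2))).const_mul (3 + 2 * B ^ 2)).add
    (((h3.const_mul (2 * Real.log 5 + 8 * Real.log 4 / Real.log 2)).add (h4.const_mul (8 / Real.log 2))).const_mul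
      (B ^ 2 + 2))
  simp only [mul_zero, add_zero] at this
  exact this

/-- `g(L) → 0`. [folklore] -/
theorem tendsto_gfun (B U : ℝ) : Tendsto (fun L : ℝ => gfun B U L) atTop (𝓝 0) := by
  have h1 : Tendsto (fun L : ℝ => Real.exp (-Real.sqrt L)) atTop (𝓝 0) :=
    Real.tendsto_exp_neg_atTop_nhds_zero.comp Real.tendsto_sqrt_atTop
  have h2 : Tendsto (fun L : ℝ => (Real.log U + 1) / L) atTop (𝓝 0) := by
    have := (tendsto_inv_atTop_zero (𝕜 := ℝ)).const_mul (Real.log U + 1)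
    rw [mul_zero] at this
    refine this.congr fun L => ?_
    rw [div_eq_mul_inv]
  have h3 : Tendsto (fun L : ℝ => (Real.sqrt L)⁻¹) atTop (𝓝 0) := tendsto_inv_atTop_zero.comp Real.tendsto_sqrt_atTop
  have := ((h1.const_mul (B + 3)).const_mul 3).add ((h2.add (h3.const_mul 2)).const_mul (B ^ 2 + 2))
  simp only [mul_zero, add_zero] at this
  exact this

/-- `κ ≤ f(w)` and `bConst2 · 26w/8^w ≤ f(w)`. [folklore] -/
theorem pieces_le_ffun (B : ℝ) (w : ℕ) :
    bConst 2 * (w : ℝ) ^ (-(1 : ℝ) / 4) ≤ ffun B w ∧ bConst 2 * (26 * (w : ℝ) / 8 ^ w) ≤ ffun B w := by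
  have hbc : 1 ≤ bConst 2 := one_le_bConst (by norm_num)
  have hlog2 : 0 < Real.log 2 := Real.log_pos (by norm_num)
  have hlog4 : 0 < Real.log 4 := Real.log_pos (by norm_num)
  have hlog5 : 0 < Real.log 5 := Real.log_pos (by norm_num)
  have hx : 0 ≤ bConst 2 * (w : ℝ) ^ (-(1 : ℝ) / 4) := by positivity
  have hy : 0 ≤ bConst 2 * (26 * (w : ℝ) / 8 ^ w) := by positivity
  have hz : 0 ≤ (B ^ 2 + 2) * ((2 * Real.log 5 + 8 * Real.log 4 / Real.log 2) * (((w : ℝ) + 1) / 64 ^ w) +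
      8 / Real.log 2 * (Real.sqrt w)⁻¹) := by positivity
  have hB2 : 0 ≤ B ^ 2 := sq_nonneg _
  unfold ffun
  generalize bConst 2 * (w : ℝ) ^ (-(1 : ℝ) / 4) = x at hx ⊢
  generalize bConst 2 * (26 * (w : ℝ) / 8 ^ w) = y at hy ⊢
  generalize (B ^ 2 + 2) * ((2 * Real.log 5 + 8 * Real.log 4 / Real.log 2) * (((w : ℝ) + 1) / 64 ^ w) +
      8 / Real.log 2 * (Real.sqrt w)⁻¹) = z at hz ⊢
  constructor <;> nlinarith [mul_nonneg hB2 hx, mul_nonneg hB2 hy]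

/-- `3(B+3)e^{-√L} ≤ g(L)` (`U ≥ 1`, `L > 0`). [folklore] -/
theorem piece_le_gfun {B U L : ℝ} (hU : 1 ≤ U) (hL : 0 < L) :
    3 * ((B + 3) * Real.exp (-Real.sqrt L)) ≤ gfun B U L := by
  unfold gfun
  have : 0 ≤ (B ^ 2 + 2) * ((Real.log U + 1) / L + 2 * (Real.sqrt L)⁻¹) := by
    have := Real.log_nonneg hU; positivity
  linarith

/-- **Thresholds for the main term**: for every `δ > 0` there are `w₁` and `L₁` such that for
`w ≥ w₁`, `R > 1` with `log R ≥ L₁` and `64^w ≤ log R`: `|S₁(W;R,R)/((W/φ(W)) log R) - 1| ≤ δ` (`W = w#`),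
and `(W/φ(W)) G_W(R) ≤ 3 log R`. [cite: GreenTaoAnnals2008, Lemma 10.3 and Appendix A Lemma A.3] -/
theorem exists_main_term_thresholds {B : ℝ} (hB : ∀ y, |moebLog y| ≤ B) {δ : ℝ} (hδ : 0 < δ) :
    ∃ w₁ : ℕ, 1 ≤ w₁ ∧ ∃ L₁ : ℝ, 1 ≤ L₁ ∧ ∀ w : ℕ, w₁ ≤ w → ∀ R : ℝ, 1 < R → L₁ ≤ Real.log R →
      (64 : ℝ) ^ w ≤ Real.log R →
      |diagSum (primorial w) R R / ((primorial w : ℝ) / ((primorial w).totient : ℝ) * Real.log R) - 1| ≤ δ ∧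
      (primorial w : ℝ) / ((primorial w).totient : ℝ) * invTotSum (primorial w) R ≤ 3 * Real.log R := by
  have hB0 : 0 ≤ B := (abs_nonneg _).trans (hB 0)
  obtain ⟨δ', hδ'0, hδ'1, hδ'δ⟩ : ∃ δ' : ℝ, 0 < δ' ∧ δ' ≤ 1 ∧ δ' ≤ δ :=
    ⟨min δ 1, lt_min hδ one_pos, min_le_right _ _, min_le_left _ _⟩
  obtain ⟨U, hU, hMU⟩ := exists_abs_moebLog_sub_one_le_of_pos (show 0 < δ' / 9 by positivity)
  obtain ⟨w₁, hw₁⟩ := ((tendsto_ffun B).eventually (gt_mem_nhds (show (0:ℝ) < δ' / 3 by positivity))).exists_forall_of_atTop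
  obtain ⟨L₁, hL₁⟩ := ((tendsto_gfun B U).eventually (gt_mem_nhds (show (0:ℝ) < δ' / 3 by positivity))).exists_forall_of_atTop
  refine ⟨max w₁ 1, le_max_right _ _, max L₁ 1, le_max_right _ _, fun w hw R hR hLR hcoup => ?_⟩
  have hw1 : 1 ≤ w := (le_max_right _ _).trans hw
  have hfw : ffun B w < δ' / 3 := hw₁ w ((le_max_left _ _).trans hw)
  have hgL : gfun B U (Real.log R) < δ' / 3 := hL₁ _ ((le_max_left _ _).trans hLR)
  have hL0 : 0 < Real.log R := Real.log_pos hR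
  obtain ⟨hκf, haf⟩ := pieces_le_ffun B w
  have hκ1 : bConst 2 * (w : ℝ) ^ (-(1 : ℝ) / 4) ≤ 1 := by linarith
  have hEg := piece_le_gfun (B := B) hU hL0
  have hη' : δ' / 9 + (B + 3) * Real.exp (-Real.sqrt (Real.log R)) ≤ 1 / 2 := by linarith
  have hbud := budget_le (B := B) (η := δ' / 9) hU hw1 hR hcoup
  -- positivity of the budget pieces, to read off `(log Y₀ + 1)/L ≤ 1`
  have hA1 := one_le_div_totient (primorial_pos w).ne'
  have hK : 0 ≤ (harmErr (primorial w) + 4) * bConst 2 := by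
    have := harmErr_nonneg (primorial w); have := one_le_bConst (show (0:ℝ) ≤ 2 by norm_num); positivity
  have ha0 : 0 ≤ (primorial w : ℝ) / ((primorial w).totient : ℝ) * ((harmErr (primorial w) + 4) * bConst 2) / Real.log R := by
    positivity
  have hκ0 : 0 ≤ bConst 2 * (w : ℝ) ^ (-(1 : ℝ) / 4) := by
    have := one_le_bConst (show (0:ℝ) ≤ 2 by norm_num); positivity
  have hE0 : 0 ≤ (B + 3) * Real.exp (-Real.sqrt (Real.log R)) := by positivity
  have hℓ0 : 0 ≤ (Real.log (cutY U w (Real.log R)) + 1) / Real.log R := by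
    have := Real.log_nonneg (one_le_cutY hU w hL0.le).2; positivity
  have hℓL : Real.log (cutY U w (Real.log R)) + 1 ≤ Real.log R := by
    have hB2 : 0 ≤ B ^ 2 := sq_nonneg _
    have hinner : 0 ≤ B ^ 2 * (2 * (bConst 2 * (w : ℝ) ^ (-(1 : ℝ) / 4)) + (Real.log (cutY U w (Real.log R)) + 1) / Real.log R +
        2 * ((primorial w : ℝ) / ((primorial w).totient : ℝ) * ((harmErr (primorial w) + 4) * bConst 2) / Real.log R)) := by
      positivity
    have hℓ1 : (Real.log (cutY U w (Real.log R)) + 1) / Real.log R ≤ 1 := by linarith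
    rwa [div_le_one hL0] at hℓ1
  have hmain := abs_diagSum_div_sub_one_le hB hU (show 0 ≤ δ' / 9 by positivity) hMU hw1 hR hκ1 hη' hℓL
  constructor
  · linarith
  · -- `A G_W(R) ≤ L(1+κ) + A K₁ ≤ 3 L`
    have hW0 : primorial w ≠ 0 := (primorial_pos w).ne'
    have hD : ∀ p, p.Prime → p ≤ w → p ∣ primorial w := fun p hp hpw => (hp.dvd_primorial_iff).2 hpw
    have hGb₂ := abs_invTotSum_sub_le hW0 hw1 hD hR.le
    obtain ⟨hfl₂, _⟩ := log_floor_bounds hR.le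
    have hAinv : ((primorial w).totient : ℝ) / (primorial w) = ((primorial w : ℝ) / ((primorial w).totient : ℝ))⁻¹ := by
      rw [inv_div]
    rw [hAinv] at hGb₂
    have hA0 : 0 < (primorial w : ℝ) / ((primorial w).totient : ℝ) := by linarith
    have hlg₂ : 0 ≤ Real.log ⌊R⌋₊ := by
      have : (1:ℝ) ≤ ⌊R⌋₊ := by exact_mod_cast Nat.le_floor (by simpa using hR.le)
      exact Real.log_nonneg this
    obtain ⟨hAG₂u, _⟩ := mul_G_bounds hA0 hκ0 hκ1 hGb₂ hfl₂ (Y := 0) hlg₂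
    have ha := aterm_le hw1 hL0 hcoup
    have haL : (primorial w : ℝ) / ((primorial w).totient : ℝ) * ((harmErr (primorial w) + 4) * bConst 2) ≤ Real.log R := by
      have : (primorial w : ℝ) / ((primorial w).totient : ℝ) * ((harmErr (primorial w) + 4) * bConst 2) / Real.log R ≤ 1 := by
        linarith
      rwa [div_le_one hL0] at this
    calc (primorial w : ℝ) / ((primorial w).totient : ℝ) * invTotSum (primorial w) R
        ≤ Real.log R * (1 + bConst 2 * (w : ℝ) ^ (-(1 : ℝ) / 4)) +
          (primorial w : ℝ) / ((primorial w).totient : ℝ) * ((harmErr (primorial w) + 4) * bConst 2) := hAG₂u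
      _ ≤ Real.log R * 2 + Real.log R := by nlinarith
      _ = 3 * Real.log R := by ring

/-! ### The box asymptotic: Proposition 9.5 for fixed `(m, t, C)` -/

/-- `|r^m - 1| ≤ δ m 2^m` when `|r - 1| ≤ δ ≤ 1`. [folklore] -/
theorem abs_pow_sub_one_le {r δ : ℝ} (h : |r - 1| ≤ δ) (hδ : δ ≤ 1) (m : ℕ) : |r ^ m - 1| ≤ δ * m * 2 ^ m := by
  have hδ0 : 0 ≤ δ := (abs_nonneg _).trans h
  have h1 : |r| ≤ 2 := by
    have := abs_sub_abs_le_abs_sub r 1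
    rw [abs_one] at this; linarith
  have h2 := abs_pow_sub_pow_le (a := r) (b := (1 : ℝ)) (n := m)
  rw [one_pow, abs_one] at h2
  refine h2.trans ?_
  have hmax : max |r| 1 ≤ 2 := max_le h1 (by norm_num)
  have hmax0 : 0 ≤ max |r| 1 := le_max_of_le_right zero_le_one
  calc |r - 1| * m * max |r| 1 ^ (m - 1) ≤ δ * m * 2 ^ (m - 1) := by
        gcongr
    _ ≤ δ * m * 2 ^ m := by
        gcongr
        · norm_num
        · exact Nat.sub_le m 1

/-- `w < 64^w ≤ log R < R`, so `w ≤ ⌊R⌋`. [folklore] -/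
theorem le_floor_of_coupling {w : ℕ} {R : ℝ} (hR : 0 < R) (hcoup : (64 : ℝ) ^ w ≤ Real.log R) : w ≤ ⌊R⌋₊ := by
  have h1 : (w : ℝ) < 64 ^ w := by exact_mod_cast Nat.lt_pow_self (by norm_num : 1 < 64)
  have h2 : Real.log R ≤ R := (Real.log_le_sub_one_of_pos hR).trans (by linarith)
  exact Nat.le_floor (by linarith)

/-- **Green–Tao 2008, Proposition 9.5 for fixed `(m, t, C)` (sharp truncation), PROVED.** For every
`ε > 0` there are `w₀` and `L₀` such that for all `w ≥ w₀` and `R > 1` with `log R ≥ L₀` and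
`64^w ≤ log R` ("`w(N)` sufficiently slowly growing"), `W = w#`, all integer systems `ψ_i(x) = ∑_j L_{ij}x_j + b_i`
(`i ≤ m`, `j ≤ t = n+1`) with `|L_{ij}| ≤ C`, nonzero pairwise non-proportional rows, and all boxes
`∏_j [a_j, a_j + ℓ_j)` with `ℓ_j ≥ R^{10m}`:
`|E_{x∈B} ∏_i Λ_R(Wψ_i(x)+1)² / (W log R/φ(W))^m - 1| ≤ ε`.
[cite: GreenTaoAnnals2008, Proposition 9.5] -/
theorem sharp_boxAsymptotic (m n C : ℕ) (hm : 1 ≤ m) {ε : ℝ} (hε : 0 < ε) :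
    ∃ w₀ : ℕ, 1 ≤ w₀ ∧ ∃ L₀ : ℝ, 1 ≤ L₀ ∧ ∀ w : ℕ, w₀ ≤ w → ∀ R : ℝ, 1 < R → L₀ ≤ Real.log R →
      (64 : ℝ) ^ w ≤ Real.log R →
      ∀ L : Fin m → Fin (n + 1) → ℤ, (∀ i j, |L i j| ≤ C) → (∀ i, L i ≠ 0) →
        (∀ i i', i ≠ i' → ∀ c : ℚ, (fun j => (L i j : ℚ)) ≠ c • fun j => (L i' j : ℚ)) →
        ∀ b : Fin m → ℤ, ∀ a : Fin (n + 1) → ℤ, ∀ ℓ : Fin (n + 1) → ℕ, (∀ j, R ^ (10 * m) ≤ ℓ j) →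
          |(𝔼 x ∈ Fintype.piFinset (fun j => Ico (a j) (a j + ℓ j)),
              ∏ i, truncatedDivisorSum R ((primorial w : ℤ) * (∑ j, L i j * x j + b i) + 1) ^ 2) /
            ((primorial w : ℝ) * Real.log R / ((primorial w).totient : ℝ)) ^ m - 1| ≤ ε := by
  classical
  obtain ⟨B, hB1, hB⟩ := exists_moebLog_bound
  have hm0 : (0 : ℝ) < m := by exact_mod_cast hm
  -- main term threshold with `ε₁ = ε/(3 m 2^m)`
  set ε₁ : ℝ := min (ε / (3 * m * 2 ^ m)) 1 with hε₁
  have hε₁0 : 0 < ε₁ := lt_min (by positivity) one_pos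
  have hε₁1 : ε₁ ≤ 1 := min_le_right _ _
  obtain ⟨w₁, hw₁1, L₁, hL₁1, hMT⟩ := exists_main_term_thresholds hB hε₁0
  -- coupled-primes threshold: `(exp(2·16^m/w) - 1)(3B²)^m ≤ ε/3`
  have htend : Tendsto (fun w : ℕ => (Real.exp (2 * 16 ^ m / (w : ℝ)) - 1) * (3 * B ^ 2) ^ m) atTop (𝓝 0) := by
    have h1 : Tendsto (fun w : ℕ => 2 * 16 ^ m / (w : ℝ)) atTop (𝓝 0) := tendsto_const_div_atTop_nhds_zero_nat _
    have h2 : Tendsto (fun w : ℕ => Real.exp (2 * 16 ^ m / (w : ℝ))) atTop (𝓝 (Real.exp 0)) :=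
      (Real.continuous_exp.tendsto 0).comp h1
    rw [Real.exp_zero] at h2
    have h3 := (h2.sub_const 1).mul_const ((3 * B ^ 2) ^ m)
    simpa using h3
  obtain ⟨w₂, hw₂⟩ := (htend.eventually (gt_mem_nhds (show (0:ℝ) < ε / 3 by positivity))).exists_forall_of_atTop
  -- thresholds
  refine ⟨max (max w₁ w₂) (2 * C ^ 2 + 1), le_trans hw₁1 ((le_max_left _ _).trans (le_max_left _ _)),
    max L₁ (max 1 (Real.log (3 * ((n : ℝ) + 1) / ε))), le_trans (le_max_left _ _) (le_max_right _ _),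
    fun w hw R hR hLR hcoup L hC hL0 hLp b a ℓ hℓ => ?_⟩
  have hw₁ : w₁ ≤ w := ((le_max_left _ _).trans (le_max_left _ _)).trans hw
  have hw₂' : w₂ ≤ w := ((le_max_right _ _).trans (le_max_left _ _)).trans hw
  have hwC : 2 * C ^ 2 ≤ w := by have := (le_max_right _ _).trans hw; omega
  have hw1 : 1 ≤ w := hw₁1.trans hw₁
  have hL₁ : L₁ ≤ Real.log R := (le_max_left _ _).trans hLR
  have hL1 : 1 ≤ Real.log R := ((le_max_left _ _).trans (le_max_right _ _)).trans hLR
  have hLε : Real.log (3 * ((n : ℝ) + 1) / ε) ≤ Real.log R := ((le_max_right _ _).trans (le_max_right _ _)).trans hLR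
  have hR0 : 0 < R := by linarith
  have hR1 : 1 ≤ R := hR.le
  obtain ⟨hDMn, hAG⟩ := hMT w hw₁ R hR hL₁ hcoup
  have hcp := hw₂ w hw₂'
  -- names
  set W := primorial w with hWdef
  have hW0 : W ≠ 0 := (primorial_pos w).ne'
  set A : ℝ := (W : ℝ) / (W.totient : ℝ) with hA
  have hA1 : 1 ≤ A := one_le_div_totient hW0
  set Lg := Real.log R with hLg
  have hLg0 : 0 < Lg := by linarith
  set Mn : ℝ := A * Lg with hMn
  have hMn1 : 1 ≤ Mn := one_le_mul_of_one_le_of_one_le hA1 hL1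
  have hMn0 : 0 < Mn := by linarith
  have hden : ((W : ℝ) * Real.log R / (W.totient : ℝ)) = Mn := by rw [hMn, hA]; ring
  rw [hden]
  -- the set of primes
  set Q : ℕ := ⌊R⌋₊ + 2 with hQ
  have hRQ : R < Q := by
    have := Nat.lt_floor_add_one R
    rw [hQ]; push_cast; linarith
  set P := Nat.primesBelow Q with hPdef
  have hP : ∀ p ∈ P, p.Prime := fun p hp => (Nat.mem_primesBelow.1 hp).2
  have hPW : ∀ p : ℕ, p.Prime → p ∣ W → p ∈ P := by
    intro p hp hpW
    have hpw : p ≤ w := (hp.dvd_primorial_iff).1 hpW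
    have := le_floor_of_coupling hR0 hcoup
    exact Nat.mem_primesBelow.2 ⟨by rw [hQ]; omega, hp⟩
  have hPR : ∀ p : ℕ, p.Prime → (p : ℝ) ≤ R → p ∈ P := by
    intro p hp hpR
    refine Nat.mem_primesBelow.2 ⟨?_, hp⟩
    have : (p : ℝ) < Q := hpR.trans_lt hRQ
    exact_mod_cast this
  have hWw : ∀ p : ℕ, p.Prime → ¬ p ∣ W → w < p := by
    intro p hp hpW
    by_contra h
    exact hpW ((hp.dvd_primorial_iff).2 (not_lt.1 h))
  -- the expansion
  have hℓ2 : ∀ j, R ^ (2 * m) ≤ ℓ j := fun j =>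
    le_trans (pow_le_pow_right₀ hR1 (by omega)) (hℓ j)
  obtain ⟨E₁, hE₁, hE⟩ := expect_prod_sq_eq_sharpTupleSum_add (m := m) hR hRQ W L b a ℓ hℓ2
  have hE' : (𝔼 x ∈ Fintype.piFinset (fun j => Ico (a j) (a j + ℓ j)),
      ∏ i, truncatedDivisorSum R ((W : ℤ) * (∑ j, L i j * x j + b i) + 1) ^ 2) =
      sharpTupleSum P W L b R + Lg ^ (2 * m) * E₁ := by
    rw [← hE]
    refine Finset.expect_congr rfl fun x _ => prod_congr rfl fun i _ => ?_
    rw [wForm_int]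
  -- the three estimates
  have hS := abs_sharpTupleSum_sub_pow_le (m := m) hP hW0 hw1 hwC hWw L hC hL0 hLp b hPW hR1 hPR hB
  set S := sharpTupleSum P W L b R with hSdef
  set D := diagSum W R R with hDdef
  set G₂ := invTotSum W R with hG₂
  have hB2 : 1 ≤ B ^ 2 := one_le_pow₀ hB1
  -- (i) coupled primes
  have hK : B ^ 2 * A ^ 2 * G₂ ≤ 3 * B ^ 2 * Mn := by
    have : A * (A * G₂) ≤ A * (3 * Lg) := mul_le_mul_of_nonneg_left hAG (by linarith)
    have e : B ^ 2 * A ^ 2 * G₂ = B ^ 2 * (A * (A * G₂)) := by ring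
    rw [e, hMn]
    nlinarith
  have hK0 : 0 ≤ B ^ 2 * A ^ 2 * G₂ := by have := invTotSum_nonneg W R; positivity
  have hexp1 : 0 ≤ Real.exp (2 * 16 ^ m / (w : ℝ)) - 1 := by linarith [Real.one_le_exp (show 0 ≤ 2 * 16 ^ m / (w : ℝ) by positivity)]
  have h_i : |S - D ^ m| / Mn ^ m ≤ ε / 3 := by
    rw [div_le_iff₀ (by positivity)]
    calc |S - D ^ m| ≤ (Real.exp (2 * 16 ^ m / (w : ℝ)) - 1) * (B ^ 2 * A ^ 2 * G₂) ^ m := hS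
      _ ≤ (Real.exp (2 * 16 ^ m / (w : ℝ)) - 1) * (3 * B ^ 2 * Mn) ^ m :=
          mul_le_mul_of_nonneg_left (pow_le_pow_left₀ hK0 hK m) hexp1
      _ = (Real.exp (2 * 16 ^ m / (w : ℝ)) - 1) * (3 * B ^ 2) ^ m * Mn ^ m := by rw [mul_pow]; ring
      _ ≤ ε / 3 * Mn ^ m := mul_le_mul_of_nonneg_right hcp.le (by positivity)
  -- (ii) main term
  have h_ii : |(D / Mn) ^ m - 1| ≤ ε / 3 := by
    have h1 := abs_pow_sub_one_le hDMn hε₁1 m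
    refine h1.trans ?_
    have : ε₁ ≤ ε / (3 * m * 2 ^ m) := min_le_left _ _
    calc ε₁ * m * 2 ^ m ≤ ε / (3 * m * 2 ^ m) * m * 2 ^ m := by gcongr
      _ = ε / 3 := by field_simp
  -- (iii) box error
  have h_iii : Lg ^ (2 * m) * |E₁| / Mn ^ m ≤ ε / 3 := by
    have hn1 : (0 : ℝ) < (n : ℝ) + 1 := by positivity
    have hsum : ∑ j : Fin (n + 1), R ^ (2 * m) / (ℓ j : ℝ) ≤ ((n : ℝ) + 1) * (R ^ (2 * m) / R ^ (10 * m)) := by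
      have hterm : ∀ j : Fin (n + 1), R ^ (2 * m) / (ℓ j : ℝ) ≤ R ^ (2 * m) / R ^ (10 * m) := fun j =>
        div_le_div_of_nonneg_left (by positivity) (by positivity) (hℓ j)
      calc ∑ j : Fin (n + 1), R ^ (2 * m) / (ℓ j : ℝ) ≤ ∑ _j : Fin (n + 1), R ^ (2 * m) / R ^ (10 * m) := sum_le_sum fun j _ => hterm j
        _ = ((n : ℝ) + 1) * (R ^ (2 * m) / R ^ (10 * m)) := by
            rw [sum_const, card_univ, Fintype.card_fin, nsmul_eq_mul]; push_cast; ring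
    have hLR : Lg ≤ R := (Real.log_le_sub_one_of_pos hR0).trans (by linarith)
    have hLpow : Lg ^ (2 * m) ≤ R ^ (2 * m) := pow_le_pow_left₀ hLg0.le hLR _
    have hE₁' : |E₁| ≤ R ^ (2 * m) * (((n : ℝ) + 1) * (R ^ (2 * m) / R ^ (10 * m))) :=
      hE₁.trans (mul_le_mul_of_nonneg_left hsum (by positivity))
    -- `Lg^{2m} |E₁| ≤ (n+1) R^{6m}/R^{10m} = (n+1)/R^{4m} ≤ (n+1)/R ≤ ε/3`
    have hRε : 3 * ((n : ℝ) + 1) / ε ≤ R := by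
      have h := Real.exp_le_exp.2 hLε
      rwa [Real.exp_log (by positivity), Real.exp_log hR0] at h
    have hmain : Lg ^ (2 * m) * |E₁| ≤ ε / 3 := by
      calc Lg ^ (2 * m) * |E₁| ≤ R ^ (2 * m) * (R ^ (2 * m) * (((n : ℝ) + 1) * (R ^ (2 * m) / R ^ (10 * m)))) :=
            mul_le_mul hLpow hE₁' (abs_nonneg _) (by positivity)
        _ = ((n : ℝ) + 1) * (R ^ (6 * m) / R ^ (10 * m)) := by ring
        _ = ((n : ℝ) + 1) / R ^ (4 * m) := by
            rw [show 10 * m = 6 * m + 4 * m by ring, pow_add]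
            field_simp
        _ ≤ ((n : ℝ) + 1) / R := by
            refine div_le_div_of_nonneg_left hn1.le hR0 ?_
            calc R = R ^ 1 := (pow_one R).symm
              _ ≤ R ^ (4 * m) := pow_le_pow_right₀ hR1 (by omega)
        _ ≤ ε / 3 := by
            rw [div_le_iff₀ hR0]
            have : 3 * ((n : ℝ) + 1) ≤ ε * R := by rw [div_le_iff₀ hε] at hRε; linarith
            linarith
    calc Lg ^ (2 * m) * |E₁| / Mn ^ m ≤ Lg ^ (2 * m) * |E₁| / 1 :=
          div_le_div_of_nonneg_left (by positivity) one_pos (one_le_pow₀ hMn1)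
      _ ≤ ε / 3 := by rw [div_one]; exact hmain
  -- combine
  rw [hE']
  have hsplit : (S + Lg ^ (2 * m) * E₁) / Mn ^ m - 1 =
      (S - D ^ m) / Mn ^ m + ((D / Mn) ^ m - 1) + Lg ^ (2 * m) * E₁ / Mn ^ m := by
    rw [div_pow]
    field_simp
    ring
  rw [hsplit]
  calc |(S - D ^ m) / Mn ^ m + ((D / Mn) ^ m - 1) + Lg ^ (2 * m) * E₁ / Mn ^ m|
      ≤ |(S - D ^ m) / Mn ^ m| + |(D / Mn) ^ m - 1| + |Lg ^ (2 * m) * E₁ / Mn ^ m| := abs_add_three _ _ _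
    _ ≤ ε / 3 + ε / 3 + ε / 3 := by
        refine add_le_add (add_le_add ?_ h_ii) ?_
        · rw [abs_div, abs_of_pos (by positivity : (0:ℝ) < Mn ^ m)]; exact h_i
        · rw [abs_div, abs_mul, abs_of_pos (by positivity : (0:ℝ) < Mn ^ m), abs_of_pos (by positivity : (0:ℝ) < Lg ^ (2 * m))]
          exact h_iii
    _ = ε := by ring

end Literature.NumberTheory.Sieve.GreenTao2008.SharpGY

/-! ### Proposition 9.8 -/

namespace Literature.NumberTheory.Sieve.GreenTao2008

open SharpGY

/-- **Green–Tao 2008, Proposition 9.8, PROVED**: the measure `ν` of Definition 9.3 (`gtMeasure k w`)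
satisfies the `(k 2^{k-1}, 3k-4, k)`-linear forms condition for every `w → ∞` below the growth bound
`G(N) = ⌊log_64 log R⌋` (`R = N^{k⁻¹2^{-k-4}}`). The printed deduction from the Goldston–Yıldırım box
asymptotic (pp. 526–528) is the tree's `linearFormsCondition_of_boxAsymptotic`; the box asymptotic for
the sharp truncation and the fixed coefficient bound `k · k!` is `sharp_boxAsymptotic` above
(Proposition 9.5 of the source, proved here through files `GreenTao2008SharpGY{Moebius,Diagonal,Tuples}`).
[cite: GreenTaoAnnals2008, Proposition 9.8] -/
theorem MeasureLinearForms_holds : MeasureLinearForms := by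
  classical
  intro k hk
  have hk1 : 1 ≤ k := by omega
  set m₀ : ℕ := k * 2 ^ (k - 1) with hm₀_def
  have hm₀1 : 1 ≤ m₀ := Nat.mul_pos hk1 (Nat.two_pow_pos _)
  -- the growth bound `G(N) = ⌊log_64 (log R)⌋`
  have hlogR : Tendsto (fun N : ℕ => Real.log (gyLevel k N)) atTop atTop := by
    have hc : 0 < (k : ℝ)⁻¹ * 2⁻¹ ^ (k + 4) := by
      have : (0 : ℝ) < k := by exact_mod_cast hk1
      positivity
    simp_rw [log_gyLevel]
    exact Tendsto.const_mul_atTop hc (Real.tendsto_log_atTop.comp tendsto_natCast_atTop_atTop)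
  have hG : Tendsto (fun N : ℕ => ⌊Real.logb 64 (Real.log (gyLevel k N))⌋₊) atTop atTop :=
    tendsto_nat_floor_atTop.comp ((Real.tendsto_logb_atTop (by norm_num)).comp hlogR)
  refine ⟨fun N => ⌊Real.logb 64 (Real.log (gyLevel k N))⌋₊, hG, fun w hw hwG => ?_⟩
  -- the function `F_N`
  set F : ℕ → ℤ → ℝ := fun N n =>
    (Nat.totient (primorial (w N)) : ℝ) / primorial (w N) *
      truncatedDivisorSum (gyLevel k N) (primorial (w N) * n + 1) ^ 2 / Real.log (gyLevel k N)
    with hF_def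
  have hF0 : ∀ N n, 0 ≤ F N n := fun N n =>
    div_nonneg (mul_nonneg (div_nonneg (Nat.cast_nonneg _) (Nat.cast_nonneg _)) (sq_nonneg _))
      (log_gyLevel_nonneg k N)
  have hν : ∀ N (x : ZMod N), gtMeasure k w N x = if InWindow (eps k) N x.val then F N x.val else 1 := by
    intro N x
    by_cases hc : eps k * N ≤ (x.val : ℝ) ∧ (x.val : ℝ) ≤ 2 * eps k * N
    · have hc' : InWindow (eps k) N x.val := by simpa [InWindow] using hc
      rw [if_pos hc']
      unfold gtMeasure
      rw [if_pos hc]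
    · have hc' : ¬ InWindow (eps k) N x.val := by simpa [InWindow] using hc
      rw [if_neg hc']
      unfold gtMeasure
      rw [if_neg hc]
  have hε2 : 2 * eps k < 1 := two_mul_eps_lt_one k
  refine linearFormsCondition_of_boxAsymptotic F (eps_pos k) hε2 hν hF0
    (fun N => gyLevel k N ^ (10 * m₀)) (tendsto_gyLevel_pow_div_atTop hk1) ?_
  -- the box asymptotic
  intro m t hm1 hmm₀ ht1 _ ε hε
  obtain ⟨n, rfl⟩ : ∃ n, t = n + 1 := ⟨t - 1, by omega⟩
  obtain ⟨w₀, _, L₀, hL₀1, H⟩ := sharp_boxAsymptotic m n (k * k.factorial) hm1 hε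
  have hev1 : ∀ᶠ N : ℕ in atTop, w₀ ≤ w N := (tendsto_atTop.1 hw) w₀
  have hev2 : ∀ᶠ N : ℕ in atTop, L₀ ≤ Real.log (gyLevel k N) := hlogR.eventually_ge_atTop L₀
  filter_upwards [hev1, hev2] with N hN1 hN2 _hNp L hL hL0 hLp b a ℓ hℓ
  set R : ℝ := gyLevel k N with hR_def
  have hlog1 : 1 ≤ Real.log R := hL₀1.trans hN2
  have hR1 : 1 < R := (Real.log_pos_iff (gyLevel_nonneg k N)).1 (by linarith)
  -- the coupling `64^{w N} ≤ log R`
  have hcoup : (64 : ℝ) ^ (w N) ≤ Real.log R := by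
    have hwle := hwG N
    calc (64 : ℝ) ^ (w N) = (64 : ℝ) ^ ((w N : ℕ) : ℝ) := by rw [Real.rpow_natCast]
      _ ≤ (64 : ℝ) ^ ((⌊Real.logb 64 (Real.log R)⌋₊ : ℕ) : ℝ) :=
          Real.rpow_le_rpow_of_exponent_le (by norm_num) (by exact_mod_cast hwle)
      _ ≤ (64 : ℝ) ^ Real.logb 64 (Real.log R) :=
          Real.rpow_le_rpow_of_exponent_le (by norm_num) (Nat.floor_le (Real.logb_nonneg (by norm_num) hlog1))
      _ = Real.log R := Real.rpow_logb (by norm_num) (by norm_num) (by linarith)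
  have hL' : ∀ i j, |L i j| ≤ ((k * k.factorial : ℕ) : ℤ) := fun i j => by
    have := hL i j; push_cast at this ⊢; exact this
  have hℓ' : ∀ j, R ^ (10 * m) ≤ ℓ j := fun j =>
    le_trans (pow_le_pow_right₀ hR1.le (by nlinarith)) (hℓ j)
  have key := H (w N) hN1 R hR1 hN2 hcoup L hL' hL0 hLp b a ℓ hℓ'
  -- normalise
  set W : ℕ := primorial (w N) with hW_def
  have hW0 : (0 : ℝ) < W := by exact_mod_cast primorial_pos (w N)
  have hφ0 : (0 : ℝ) < Nat.totient W := by exact_mod_cast Nat.totient_pos.2 (primorial_pos (w N))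
  have hlogR0 : 0 < Real.log R := by linarith
  set M : ℝ := (W : ℝ) * Real.log R / Nat.totient W with hM_def
  have hM0 : 0 < M := by positivity
  have hFM : ∀ z : ℤ, F N z = M⁻¹ * truncatedDivisorSum R ((W : ℤ) * z + 1) ^ 2 := by
    intro z
    simp only [hF_def, hM_def, hW_def, hR_def]
    field_simp
  have hprod : ∀ x : Fin (n + 1) → ℤ, ∏ i, F N (∑ j, L i j * x j + b i) =
      M⁻¹ ^ m * ∏ i, truncatedDivisorSum R ((W : ℤ) * (∑ j, L i j * x j + b i) + 1) ^ 2 := by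
    intro x
    rw [prod_congr rfl fun i _ => hFM _, prod_mul_distrib, prod_const, card_univ, Fintype.card_fin]
  simp_rw [hprod]
  rw [← mul_expect, inv_pow, ← div_eq_inv_mul]
  exact key

end Literature.NumberTheory.Sieve.GreenTao2008
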